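import Literature.RingTheory.MvPolynomial.HomogeneousDimension
import Mathlib.RingTheory.Ideal.Colon
import Mathlib.RingTheory.Ideal.MinimalPrime.Localization
import HarnessLib

/-!
# Saturation by an element and prime chains below a minimal prime: two ring-theoretic steps
# of the multigraded Bézout count

Topic: `Literature/RingTheory/MvPolynomial`.

* **`exists_saturation`** — for an ideal `K` of a Noetherian ring and an element `Q` there is
  `N` such that `K̃ = (K : Q^N)` is the saturation `⋃_M (K : Q^M)`; `Q` is a non-zero-divisor
  modulo `K̃`, `K ≤ K̃`, and `K = K̃ ∩ (K + (Q^N))` (the ideal-theoretic form of "remove the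
  components lying in `V(Q)`", used to drop excess components before cutting by `Q`);
  `mem_minimalPrimes_of_mem_minimalPrimes_saturation` — the minimal primes of `K̃` are minimal
  primes of `K` not containing `Q` (Mathlib `Ideal.exists_mul_mem_of_mem_minimalPrimes`).
* **`exists_prime_le_forall_mem_of_list`** — in `S = K[X_0, …, X_{m-1}]`: given primes
  `𝔮 ≤ 𝔓` and a list of elements of `𝔓`, there is a prime between `𝔮` and `𝔓` containing the
  list, of dimension at least `dim S/𝔮 - (length of the list)` (Krull's principal ideal theorem
  one element at a time, `ringKrullDim_quotient_add_one_of_mem_minimalPrimes_sup_span`); whence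
  **`not_mem_of_minimal_of_lt`**: if `𝔓` is a MINIMAL prime of an ideal containing a list `L`
  of elements, and `𝔮 ≤ 𝔓` is a prime containing that ideal's other generators with
  `dim S/𝔓 + |L| < dim S/𝔮 + 1`… — packaged in the form used by the count: a prime `𝔮 ≤ 𝔓`
  of dimension `> dim S/𝔓 + |L|` cannot contain an element `x` when `𝔓` is minimal over an
  ideal generated inside `𝔮 + (x) + (L)` (a system of parameters at an isolated component cuts
  properly at every stage; pure dimension count, no Cohen–Macaulay theory).

[folklore]
-/

noncomputable section

namespace Literature.RingTheory.MvPolynomial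

/-! ## Saturation by an element -/

/-- **Saturation of an ideal by an element** in a Noetherian ring: there is `N` with
`(K : Q^N) = ⋃_M (K : Q^M)`; then `K̃ = (K : Q^N)` contains `K`, `Q` is a non-zero-divisor
modulo `K̃` (also in the iterated form `y Q^j ∈ K̃ ⇒ y ∈ K̃`), and `K = K̃ ∩ (K + (Q^N))`.
[folklore] -/
theorem exists_saturation {R : Type*} [CommRing R] [IsNoetherianRing R] (K : Ideal R) (Q : R) :
    ∃ N : ℕ, (∀ x, x ∈ K.colon {Q ^ N} ↔ ∃ M, x * Q ^ M ∈ K) ∧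
      (∀ y, y * Q ∈ K.colon {Q ^ N} → y ∈ K.colon {Q ^ N}) ∧
      K ≤ K.colon {Q ^ N} ∧
      K = K.colon {Q ^ N} ⊓ (K ⊔ Ideal.span {Q ^ N}) ∧
      (∀ (j : ℕ) (y), y * Q ^ j ∈ K.colon {Q ^ N} → y ∈ K.colon {Q ^ N}) := by
  have hcol : ∀ (M : ℕ) (x : R), x ∈ K.colon {Q ^ M} ↔ x * Q ^ M ∈ K := fun M x => by
    rw [Submodule.mem_colon_singleton, smul_eq_mul]
  -- the increasing chain `(K : Q^M)` stabilises
  have hmono : Monotone fun M : ℕ => K.colon {Q ^ M} := by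
    intro M M' hMM' x hx
    rw [hcol] at hx ⊢
    obtain ⟨d, rfl⟩ := Nat.exists_eq_add_of_le hMM'
    rw [pow_add, ← mul_assoc]
    exact K.mul_mem_right _ hx
  obtain ⟨N, hN⟩ := (monotone_stabilizes_iff_noetherian (R := R) (M := R)).mpr inferInstance
    ⟨fun M => K.colon {Q ^ M}, hmono⟩
  have hstab : ∀ M, N ≤ M → K.colon {Q ^ N} = K.colon {Q ^ M} := fun M hM => hN M hM
  have hmem : ∀ x, x ∈ K.colon {Q ^ N} ↔ ∃ M, x * Q ^ M ∈ K := by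
    intro x
    constructor
    · intro hx
      exact ⟨N, (hcol N x).mp hx⟩
    · rintro ⟨M, hM⟩
      have hx : x ∈ K.colon {Q ^ M} := (hcol M x).mpr hM
      rcases le_total M N with h | h
      · exact hmono h hx
      · rw [hstab M h]; exact hx
  have hnzd : ∀ y, y * Q ∈ K.colon {Q ^ N} → y ∈ K.colon {Q ^ N} := by
    intro y hy
    rw [hcol, mul_assoc, ← pow_succ'] at hy
    rw [hstab (N + 1) (Nat.le_succ N), hcol]
    exact hy
  have hnzd' : ∀ (j : ℕ) (u : R), u * Q ^ j ∈ K.colon {Q ^ N} → u ∈ K.colon {Q ^ N} := by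
    intro j
    induction j with
    | zero => intro u hu; simpa using hu
    | succ j ihj =>
      intro u hu
      rw [pow_succ, ← mul_assoc] at hu
      exact ihj u (hnzd _ hu)
  have hle : K ≤ K.colon {Q ^ N} := fun x hx => by
    rw [hcol]
    exact K.mul_mem_right _ hx
  refine ⟨N, hmem, hnzd, hle, le_antisymm (le_inf hle le_sup_left) ?_, hnzd'⟩
  rintro x ⟨hx1, hx2⟩
  obtain ⟨k, hk, z, hz, rfl⟩ := Submodule.mem_sup.mp hx2
  obtain ⟨y, rfl⟩ := Ideal.mem_span_singleton'.mp hz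
  -- `y Q^N = x - k ∈ K̃`, hence `y ∈ K̃`, hence `y Q^N ∈ K`
  have hyQ : y * Q ^ N ∈ K.colon {Q ^ N} := by
    have := (K.colon {Q ^ N}).sub_mem hx1 (hle hk)
    rwa [add_sub_cancel_left] at this
  have hy : y ∈ K.colon {Q ^ N} := hnzd' N y hyQ
  rw [hcol] at hy
  exact K.add_mem hk hy

/-- **The minimal primes of the saturation `K̃ = (K : Q^∞)` are minimal primes of `K` and do
not contain `Q`.** [folklore] -/
theorem mem_minimalPrimes_of_mem_minimalPrimes_saturation {R : Type*} [CommRing R]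
    {K Ktil : Ideal R} {Q : R} (hle : K ≤ Ktil) (hmem : ∀ x, x ∈ Ktil ↔ ∃ M, x * Q ^ M ∈ K)
    (hnzd : ∀ y, y * Q ∈ Ktil → y ∈ Ktil) {𝔮 : Ideal R} (h𝔮 : 𝔮 ∈ Ktil.minimalPrimes) :
    𝔮 ∈ K.minimalPrimes ∧ Q ∉ 𝔮 := by
  have h𝔮prime : 𝔮.IsPrime := h𝔮.1.1
  have hQ : Q ∉ 𝔮 := by
    intro hQ
    obtain ⟨y, hy, hQy⟩ := Ideal.exists_mul_mem_of_mem_minimalPrimes h𝔮 hQ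
    exact hy (hnzd y (by rw [mul_comm]; exact hQy))
  refine ⟨?_, hQ⟩
  -- a minimal prime `𝔮₀` of `K` below `𝔮` contains `K̃` (as `Q ∉ 𝔮₀`), so equals `𝔮`
  obtain ⟨𝔮₀, h𝔮₀, h𝔮₀le⟩ := Ideal.exists_minimalPrimes_le (hle.trans h𝔮.1.2)
  have h𝔮₀prime : 𝔮₀.IsPrime := h𝔮₀.1.1
  have hQ₀ : Q ∉ 𝔮₀ := fun h => hQ (h𝔮₀le h)
  have hKtil : Ktil ≤ 𝔮₀ := by
    intro x hx
    obtain ⟨M, hM⟩ := (hmem x).mp hx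
    exact (h𝔮₀prime.mem_or_mem (h𝔮₀.1.2 hM)).resolve_right
      (fun h => hQ₀ (h𝔮₀prime.mem_of_pow_mem M h))
  have heq : 𝔮₀ = 𝔮 := le_antisymm h𝔮₀le (h𝔮.2 ⟨h𝔮₀prime, hKtil⟩ h𝔮₀le)
  rw [← heq]
  exact h𝔮₀

/-! ## Prime chains below a fixed prime -/

variable {K : Type*} [Field K] {m : ℕ}

/-- **Adding elements one at a time to a prime, staying below a fixed prime `𝔓`**: given primes
`𝔮 ≤ 𝔓` of `S = K[X_0, …, X_{m-1}]` with `dim S/𝔮 = d` and a list `L` of elements of `𝔓`,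
there is a prime `𝔮'` with `𝔮 ≤ 𝔮' ≤ 𝔓` containing all of `L` and `d ≤ dim S/𝔮' + |L|`
(each element either already lies in the current prime or lowers the dimension of a minimal prime
over it by exactly one, `ringKrullDim_quotient_add_one_of_mem_minimalPrimes_sup_span`).
[folklore] -/
theorem exists_prime_le_forall_mem_of_list {𝔓 : Ideal (MvPolynomial (Fin m) K)} [𝔓.IsPrime] :
    ∀ (L : List (MvPolynomial (Fin m) K)) (𝔮 : Ideal (MvPolynomial (Fin m) K)), 𝔮.IsPrime →
      𝔮 ≤ 𝔓 → (∀ x ∈ L, x ∈ 𝔓) → ∀ d : ℕ, ringKrullDim (MvPolynomial (Fin m) K ⧸ 𝔮) = d →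
      ∃ 𝔮' : Ideal (MvPolynomial (Fin m) K), 𝔮'.IsPrime ∧ 𝔮 ≤ 𝔮' ∧ 𝔮' ≤ 𝔓 ∧
        (∀ x ∈ L, x ∈ 𝔮') ∧ ∃ d' : ℕ, ringKrullDim (MvPolynomial (Fin m) K ⧸ 𝔮') = d' ∧
          d ≤ d' + L.length := by
  intro L
  induction L with
  | nil =>
    intro 𝔮 h𝔮 hle _ d hd
    exact ⟨𝔮, h𝔮, le_rfl, hle, fun x hx => by simp at hx, d, hd, by simp⟩
  | cons x L ih =>
    intro 𝔮 h𝔮 hle hL d hd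
    haveI := h𝔮
    by_cases hx : x ∈ 𝔮
    · obtain ⟨𝔮', h1, h2, h3, h4, d', h5, h6⟩ :=
        ih 𝔮 h𝔮 hle (fun y hy => hL y (List.mem_cons_of_mem _ hy)) d hd
      refine ⟨𝔮', h1, h2, h3, ?_, d', h5, ?_⟩
      · intro y hy
        rcases List.mem_cons.mp hy with rfl | hy
        · exact h2 hx
        · exact h4 y hy
      · rw [List.length_cons]; omega
    · -- cut by `x`: a minimal prime of `𝔮 + (x)` below `𝔓`, of dimension `d - 1`
      have hsup : 𝔮 ⊔ Ideal.span {x} ≤ 𝔓 :=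
        sup_le hle ((Ideal.span_singleton_le_iff_mem _).mpr (hL x List.mem_cons_self))
      obtain ⟨𝔮₁, h𝔮₁min, h𝔮₁le⟩ := Ideal.exists_minimalPrimes_le hsup
      have h𝔮₁prime : 𝔮₁.IsPrime := h𝔮₁min.1.1
      have hdim := ringKrullDim_quotient_add_one_of_mem_minimalPrimes_sup_span hx h𝔮₁min
      rw [hd] at hdim
      -- `dim S/𝔮₁` is a natural number `d₁` with `d₁ + 1 = d`
      obtain ⟨d₁, hd₁, -⟩ := exists_nat_ringKrullDim_quotient_eq (K := K) h𝔮₁prime.ne_top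
      rw [hd₁] at hdim
      have hd₁d : d₁ + 1 = d := by exact_mod_cast hdim
      obtain ⟨𝔮', h1, h2, h3, h4, d', h5, h6⟩ :=
        ih 𝔮₁ h𝔮₁prime h𝔮₁le (fun y hy => hL y (List.mem_cons_of_mem _ hy)) d₁ hd₁
      refine ⟨𝔮', h1, (le_sup_left.trans h𝔮₁min.1.2).trans h2, h3, ?_, d', h5, ?_⟩
      · intro y hy
        rcases List.mem_cons.mp hy with rfl | hy
        · exact h2 (h𝔮₁min.1.2 (Ideal.mem_sup_right (Ideal.mem_span_singleton_self _)))
        · exact h4 y hy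
      · rw [List.length_cons]; omega

/-- **A system of parameters at an isolated component cuts properly**: let `𝔓` be a MINIMAL
prime of an ideal `𝔞` of `S = K[X_0, …, X_{m-1}]` with `dim S/𝔓 = e`, let `𝔮 ≤ 𝔓` be a prime
of dimension `d`, and let `x` and a list `L` of elements of `𝔓` be such that
`𝔞 ≤ 𝔮 + (x) + (L)`-in-the-weak-sense: every prime between `𝔮` and `𝔓` containing `x` and `L`
contains `𝔞`. If `e + |L| < d`, then `x ∉ 𝔮`. (Otherwise the chain construction produces a
prime `𝔮' ⊊ 𝔓` over `𝔞`.) [folklore] -/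
theorem not_mem_of_mem_minimalPrimes_of_lt {𝔞 𝔓 𝔮 : Ideal (MvPolynomial (Fin m) K)}
    (h𝔓 : 𝔓 ∈ 𝔞.minimalPrimes) [𝔮.IsPrime] (hle : 𝔮 ≤ 𝔓) {x : MvPolynomial (Fin m) K}
    {L : List (MvPolynomial (Fin m) K)} (hL : ∀ y ∈ L, y ∈ 𝔓)
    (hgen : ∀ 𝔮' : Ideal (MvPolynomial (Fin m) K), 𝔮'.IsPrime → 𝔮 ≤ 𝔮' → x ∈ 𝔮' →
      (∀ y ∈ L, y ∈ 𝔮') → 𝔞 ≤ 𝔮')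
    {d e : ℕ} (hd : ringKrullDim (MvPolynomial (Fin m) K ⧸ 𝔮) = d)
    (he : ringKrullDim (MvPolynomial (Fin m) K ⧸ 𝔓) = e) (hlt : e + L.length < d) :
    x ∉ 𝔮 := by
  intro hx
  haveI : 𝔓.IsPrime := h𝔓.1.1
  obtain ⟨𝔮', h1, h2, h3, h4, d', h5, h6⟩ :=
    exists_prime_le_forall_mem_of_list L 𝔮 inferInstance hle hL d hd
  have h𝔞 : 𝔞 ≤ 𝔮' := hgen 𝔮' h1 h2 (h2 hx) h4
  have heq : 𝔮' = 𝔓 := le_antisymm h3 (h𝔓.2 ⟨h1, h𝔞⟩ h3)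
  rw [heq, he] at h5
  have : (e : WithBot ℕ∞) = (d' : WithBot ℕ∞) := h5
  have hed : e = d' := by exact_mod_cast this
  omega

end Literature.RingTheory.MvPolynomial

end
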